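import Summits.NavierStokesRegularity.NavierStokesRegularity.Theorems.Target.Negative.EnergyClassLoadBearing
import Summits.NavierStokesRegularity.NavierStokesRegularity.Theorems.TypeICertificateLadderNoTypeIBlowupTypeIMorrey
import Literature.Analysis.FluidPDE.KNSSTypeIIHolds
import Literature.Analysis.FluidPDE.NSLerayBlowupRateTopHolds
import Literature.Analysis.FluidPDE.NSCriticalClosureProofs
import Literature.Analysis.FluidPDE.TaoLocalisationHolds
import Literature.Analysis.FluidPDE.ClassicalSuitable
import Literature.Analysis.FluidPDE.KNSSAxisymmetricNoSwirl
import Literature.Barriers.NavierStokesRegularity.AxisymmetricTypeIExclusionHolds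
import Literature.Analysis.FluidPDE.KNSSNoAxisymmetricTypeIHolds
import Literature.Barriers.NavierStokesRegularity.LeraySelfSimilarBlowupExclusionProofs
import Literature.Analysis.FluidPDE.ChaeWolfRemovingDSSProofs
import Literature.Analysis.FluidPDE.ConstantinDirectionDissipationProofs

/-!
# Crux `Target` = `TypeICertificateLadder.NoTypeIBlowup` (stmt-NavierStokesRegularity-1217), negative side:
# the profile of a counterexample, and what a kill must contain

Negative-side (cdisprove, D-0016) structure theorems extracted from `Cruxes/Target/Disproof.lean`
§§4, 4b (gen 2–3), importable; all are consequences of PROVED tree theorems (standard axioms) about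
a hypothetical counterexample `(ν, T, u, p)` (classical on `[0, T)`, Leray–Hopf from the rapidly
decaying datum `u 0`, Type-I rate, no classical extension past `T`): it is the maximal Kato
`C_t L³` mild solution from its datum (`counterexample_isKato`, `counterexample_kato_maximal`),
unbounded on `[0, T) × ℝ³` (`counterexample_unbounded`) yet pointwise bounded on every earlier slab
(`pointwise_bounded_before`), with a singular POINT `(T, x₀)` (`counterexample_singular_point`),
Leray's lower rate and hence Type-I constant `≥ c√ν` (`counterexample_typeI_constant_ge`); it is
NOT axisymmetric (`target_axisymmetric`), NOT exactly backward self-similar (`target_selfSimilar`),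
NOT modelled on a `λ`-DSS ancient solution with `λ < λ₁(C₀)` (`target_dss_near_one`); and WHAT A
KILL MUST CONTAIN: an Albritton–Barker local Type-I singular point
(`localTypeISingularityExists_of_not_target`, unconditional), modulo `AlbrittonBarkerForward` a
non-trivial mild bounded ancient solution with `𝐈 < ∞`, and modulo its measurable-slice form a
refutation of the KNSS Liouville conjecture (`not_liouvilleConjectureNS_of_not_target`).
Nothing here closes the item (`--supports`).
[cite: KochNadirashviliSereginSverak2009, Thms. 6.1–6.2] [cite: AlbrittonBarker2019, Thm. 1.1]
-/

noncomputable section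

open MeasureTheory TopologicalSpace Set Function Filter Metric
open scoped Topology RealInnerProductSpace ContDiff Laplacian InnerProductSpace
open Literature.Analysis.FluidPDE Literature.Barriers.NavierStokesRegularity

namespace Summit.NavierStokesRegularity.NavierStokesRegularity.Theorems.Target.Negative

/-- Local notation for physical space `ℝ³ = EuclideanSpace ℝ (Fin 3)`. -/
local notation "ℝ³" => EuclideanSpace ℝ (Fin 3)

/-! ## §4 Profile of a counterexample (consequences of proved tree theorems) -/

section Profile

variable {ν T : ℝ} {u : ℝ → ℝ³ → ℝ³} {p : ℝ → ℝ³ → ℝ}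

/-- A counterexample is a maximal smooth solution with lifespan `T`. -/
theorem counterexample_isMaximal (hcl : IsClassicalNSSolutionOn (Ico 0 T) ν 0 u p)
    (hext : ¬ HasSmoothExtensionPast ν 0 u T) : IsMaximalSmoothSolution ν 0 u p T :=
  ⟨hcl, hext⟩

/-- **A counterexample is genuinely unbounded on `[0, T) × ℝ³`** (contrapositive of the proved
continuation theorem `hasSmoothExtensionPast_of_bounded_holds`, RRS 2016 Thm 8.17). Neither the
decay of the datum nor the Type-I rate is needed for this. -/
theorem counterexample_unbounded (hν : 0 < ν) (hT : 0 < T)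
    (hcl : IsClassicalNSSolutionOn (Ico 0 T) ν 0 u p) (hLH : IsLerayHopfOn T ν 0 (u 0) u)
    (hext : ¬ HasSmoothExtensionPast ν 0 u T) :
    ∀ M : ℝ, ∃ t ∈ Ico 0 T, ∃ x, M < ‖u t x‖ := by
  intro M
  by_contra h
  have hb : ∀ t ∈ Ico 0 T, ∀ x, ‖u t x‖ ≤ M := fun t ht x =>
    not_lt.1 fun hlt => h ⟨t, ht, x, hlt⟩
  exact hext (hasSmoothExtensionPast_of_bounded_holds hν hT hcl hLH ⟨M, hb⟩)

/-- **… but it is essentially bounded on every earlier slab `[0, T'] × ℝ³`, `T' < T`** (proved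
tree theorem `eLpNorm_uncurry_top_lt_top_of_tao2011` with the discharged
`tao2011_hasBoundedSobolevNormsOn_holds`: finite-energy classical solutions from Schwartz data
have bounded Sobolev norms on closed slabs). So the blow-up of a counterexample happens exactly
at `T`, not before and not at spatial infinity at an earlier time. -/
theorem counterexample_bounded_before (hν : 0 < ν)
    (hcl : IsClassicalNSSolutionOn (Ico 0 T) ν 0 u p) (hLH : IsLerayHopfOn T ν 0 (u 0) u)
    (hdec : HasRapidSpatialDecay (u 0)) :
    ∀ T' ∈ Ioo 0 T, eLpNorm (uncurry u) ⊤ (volume.restrict (Icc 0 T' ×ˢ univ)) < ⊤ :=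
  eLpNorm_uncurry_top_lt_top_of_tao2011 tao2011_hasBoundedSobolevNormsOn_holds hν hcl hLH hdec

/-- **Leray's lower rate for a counterexample**: with Leray's universal constant `c > 0`
(`leray_blowup_rate_top_holds`, Leray 1934 §19 (3.9)), every counterexample satisfies
`‖u(t)‖_{L^∞} ≥ c √ν / √(T - t)` for EVERY `t ∈ [0, T)`. -/
theorem counterexample_leray_lower_bound :
    ∃ c : ℝ, 0 < c ∧ ∀ ⦃ν T : ℝ⦄ ⦃u : ℝ → ℝ³ → ℝ³⦄ ⦃p : ℝ → ℝ³ → ℝ⦄, 0 < ν → 0 < T →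
      IsClassicalNSSolutionOn (Ico 0 T) ν 0 u p → IsLerayHopfOn T ν 0 (u 0) u →
      HasRapidSpatialDecay (u 0) → ¬ HasSmoothExtensionPast ν 0 u T →
      ∀ t ∈ Ico 0 T, ENNReal.ofReal (c * Real.sqrt ν / Real.sqrt (T - t)) ≤ eLpNorm (u t) ⊤ volume := by
  obtain ⟨c, hc, h⟩ := leray_blowup_rate_top_holds
  exact ⟨c, hc, fun ν T u p hν hT hcl hLH hdec hext =>
    h ν T hν hT u p ⟨hcl, hext⟩ hLH (counterexample_bounded_before hν hcl hLH hdec)⟩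

/-- **The Type-I constant of a counterexample is at least Leray's**: `c √ν ≤ C` for every `C`
admissible in `IsTypeIBlowup u T` (in the normal form `ν = 1`: the one dimensionless parameter
of the counterexample search satisfies `C ≥ c_Leray`; the route's `RungZero`, stmt-…-2886, is the
positive reading). Hand calibration of the triage panel (module docstring, (a)): in fact
`C ≥ √ν`, even `≥ 1.035 √ν` — not Lean-checked here. -/
theorem counterexample_typeI_constant_ge :
    ∃ c : ℝ, 0 < c ∧ ∀ ⦃ν T : ℝ⦄ ⦃u : ℝ → ℝ³ → ℝ³⦄ ⦃p : ℝ → ℝ³ → ℝ⦄, 0 < ν → 0 < T →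
      IsClassicalNSSolutionOn (Ico 0 T) ν 0 u p → IsLerayHopfOn T ν 0 (u 0) u →
      HasRapidSpatialDecay (u 0) → ¬ HasSmoothExtensionPast ν 0 u T →
      ∀ C : ℝ, (∀ᶠ t in 𝓝[<] T, ∀ x, ‖u t x‖ ≤ C / Real.sqrt (T - t)) → c * Real.sqrt ν ≤ C := by
  obtain ⟨c, hc, h⟩ := counterexample_leray_lower_bound
  refine ⟨c, hc, fun ν T u p hν hT hcl hLH hdec hext C hC => ?_⟩
  obtain ⟨T₁, hT₁T, hT₁⟩ := mem_nhdsLT_iff_exists_Ioo_subset.1 hC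
  have hT₁T' : T₁ < T := hT₁T
  -- a time in `[0, T) ∩ (T₁, T)`
  set t : ℝ := max ((T₁ + T) / 2) 0 with ht
  have htT : t < T := max_lt (by linarith) hT
  have htT₁ : T₁ < t := lt_of_lt_of_le (by linarith) (le_max_left _ _)
  have ht0 : 0 ≤ t := le_max_right _ _
  have hlow := h hν hT hcl hLH hdec hext t ⟨ht0, htT⟩
  have hup : eLpNorm (u t) ⊤ volume ≤ ENNReal.ofReal (C / Real.sqrt (T - t)) := by
    rw [eLpNorm_exponent_top]
    exact eLpNormEssSup_le_of_ae_bound (ae_of_all _ (hT₁ ⟨htT₁, htT⟩))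
  have hsq : 0 < Real.sqrt (T - t) := Real.sqrt_pos.2 (sub_pos.2 htT)
  have hpos : 0 < c * Real.sqrt ν / Real.sqrt (T - t) := by positivity
  have hle := (ENNReal.ofReal_le_ofReal_iff' ).1 (hlow.trans hup)
  rcases hle with hle | hle
  · rwa [div_le_div_iff_of_pos_right hsq] at hle
  · exact absurd hle (not_le.2 hpos)

/-- Measure-theoretic pattern used twice: an a.e. bound `g ≤ S` on `A` is incompatible with
`S < g` on a positive-measure measurable subset `U ⊆ A`. -/
theorem false_of_ae_le_of_lt_on {α : Type*} [MeasurableSpace α] {μ : Measure α} {g : α → ENNReal}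
    {S : ENNReal} {A U : Set α} (hae : ∀ᵐ z ∂(μ.restrict A), g z ≤ S) (hUA : U ⊆ A)
    (hU : MeasurableSet U) (hpos : μ U ≠ 0) (hbig : ∀ z ∈ U, S < g z) : False := by
  have h1 : ∀ᵐ z ∂(μ.restrict U), g z ≤ S := ae_restrict_of_ae_restrict_of_subset hUA hae
  have h2 : ∀ᵐ z ∂(μ.restrict U), S < g z := (ae_restrict_iff' hU).2 (ae_of_all _ hbig)
  have h3 : ∀ᵐ z ∂(μ.restrict U), False := by
    filter_upwards [h1, h2] with z h1 h2 using absurd h1 (not_le.2 h2)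
  have hzero : μ.restrict U = 0 := by
    rwa [Filter.eventually_false_iff_eq_bot, ae_eq_bot] at h3
  exact hpos (Measure.restrict_eq_zero.1 hzero)

/-- **A counterexample IS the Kato (mild, `C_t L³`) solution from its datum** — the weak–strong
identification behind "why it resists": the crux is a statement about THE mild solution from a
Schwartz datum (tree theorem `isKatoSolutionOn_of_classical`). -/
theorem counterexample_isKato (hν : 0 < ν) (hT : 0 < T)
    (hcl : IsClassicalNSSolutionOn (Ico 0 T) ν 0 u p) (hLH : IsLerayHopfOn T ν 0 (u 0) u)
    (hdec : HasRapidSpatialDecay (u 0)) : IsKatoSolutionOn T ν (u 0) u :=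
  isKatoSolutionOn_of_classical hν hT hcl hLH hdec

/-- … and `T` is the maximal time of the Kato solution: no Kato solution from `u 0` lives on a
longer interval (tree theorem `not_isKatoSolutionOn_of_not_hasSmoothExtensionPast`). So a
counterexample is a genuine finite-time blow-up of the mild solution from a Schwartz datum. -/
theorem counterexample_kato_maximal (hν : 0 < ν) (hT : 0 < T)
    (hcl : IsClassicalNSSolutionOn (Ico 0 T) ν 0 u p) (hLH : IsLerayHopfOn T ν 0 (u 0) u)
    (hdec : HasRapidSpatialDecay (u 0)) (hext : ¬ HasSmoothExtensionPast ν 0 u T) :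
    ∀ T' : ℝ, T < T' → ∀ v : ℝ → ℝ³ → ℝ³, ¬ IsKatoSolutionOn T' ν (u 0) v :=
  not_isKatoSolutionOn_of_not_hasSmoothExtensionPast hν hT hcl hLH hdec hext

/-- **A counterexample has a singular POINT `(T, x₀)`**: the blow-up is localised in space as well
— some `x₀` with `‖u‖_{L^∞(Q_r(T, x₀))} = ∞` for every `0 < r`, `r² < T` (Lemarié-Rieusset 2016
Thm 15.1 (C): far-field bound of Kato solutions + compactness; tree theorem
`exists_singularPoint_of_classical_of_not_hasSmoothExtensionPast`). -/
theorem counterexample_singular_point (hν : 0 < ν) (hT : 0 < T)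
    (hcl : IsClassicalNSSolutionOn (Ico 0 T) ν 0 u p) (hLH : IsLerayHopfOn T ν 0 (u 0) u)
    (hdec : HasRapidSpatialDecay (u 0)) (hext : ¬ HasSmoothExtensionPast ν 0 u T) :
    ∃ x₀ : ℝ³, ∀ r : ℝ, 0 < r → r ^ 2 < T →
      eLpNorm (uncurry u) ⊤ (volume.restrict (parabolicCylinder r ((T : ℝ), x₀))) = ⊤ :=
  exists_singularPoint_of_classical_of_not_hasSmoothExtensionPast hν hT hcl hLH hdec hext

/-- **A.e.-to-everywhere upgrade**: a classical Leray–Hopf solution from a rapidly decaying datum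
is bounded POINTWISE on every earlier closed slab `[0, T'] × ℝ³`, `T' < T` (the essential bound
of `counterexample_bounded_before` on a slightly larger slab, plus joint continuity: a value above
the essential bound would persist on an open box of positive measure inside that slab). This is
exactly the sub-slab hypothesis `hbdd` of the tree's `knss_no_axisymmetric_typeI`. -/
theorem pointwise_bounded_before (hν : 0 < ν)
    (hcl : IsClassicalNSSolutionOn (Ico 0 T) ν 0 u p) (hLH : IsLerayHopfOn T ν 0 (u 0) u)
    (hdec : HasRapidSpatialDecay (u 0)) :
    ∀ T' < T, ∃ M : ℝ, ∀ t ∈ Icc 0 T', ∀ x, ‖u t x‖ ≤ M := by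
  intro T' hT'T
  rcases lt_or_ge T' 0 with hneg | hT'0
  · exact ⟨0, fun t ht _ => absurd (ht.1.trans ht.2) (not_le.2 hneg)⟩
  -- an intermediate time `T' < T'' < T`
  set T'' : ℝ := (T' + T) / 2 with hT''
  have hT'T'' : T' < T'' := by rw [hT'']; linarith
  have hT''T : T'' < T := by rw [hT'']; linarith
  have hT''pos : 0 < T'' := lt_of_le_of_lt hT'0 hT'T''
  -- the a.e. bound on the slab `[0, T''] × ℝ³`
  have hfin := counterexample_bounded_before hν hcl hLH hdec T'' ⟨hT''pos, hT''T⟩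
  rw [eLpNorm_exponent_top] at hfin
  set A : Set (ℝ × ℝ³) := Icc 0 T'' ×ˢ univ with hA
  set S := eLpNormEssSup (uncurry u) ((volume : Measure (ℝ × ℝ³)).restrict A) with hS
  have hae : ∀ᵐ z ∂((volume : Measure (ℝ × ℝ³)).restrict A), ‖uncurry u z‖ₑ ≤ S :=
    enorm_ae_le_eLpNormEssSup _ _
  set K : ℝ := S.toReal with hK
  have hSK : S = ENNReal.ofReal K := (ENNReal.ofReal_toReal hfin.ne).symm
  refine ⟨K, fun t ht x => ?_⟩
  by_contra hKx
  have hKx : K < ‖u t x‖ := not_le.1 hKx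
  -- the large value persists on an open box inside the slab
  have hcont : ContinuousOn (uncurry u) (Ico 0 T ×ˢ univ) := hcl.smooth_velocity.continuousOn
  have htT : t < T := (ht.2.trans_lt hT'T'').trans hT''T
  have hmem : (t, x) ∈ Ico 0 T ×ˢ (univ : Set ℝ³) := mk_mem_prod ⟨ht.1, htT⟩ (mem_univ _)
  have hpre : {z : ℝ × ℝ³ | K < ‖uncurry u z‖} ∈ 𝓝[Ico 0 T ×ˢ univ] ((t, x) : ℝ × ℝ³) :=
    (hcont (t, x) hmem).preimage_mem_nhdsWithin
      ((isOpen_lt continuous_const continuous_norm).mem_nhds hKx)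
  obtain ⟨W, hW, hWsub⟩ := mem_nhdsWithin_iff_exists_mem_nhds_inter.1 hpre
  obtain ⟨δ, hδ, hball⟩ := Metric.mem_nhds_iff.1 hW
  set t₂ : ℝ := min (t + δ) T'' with ht₂
  have htt₂ : t < t₂ := lt_min (by linarith) (ht.2.trans_lt hT'T'')
  set U : Set (ℝ × ℝ³) := Ioo t t₂ ×ˢ ball x δ with hU
  have hUA : U ⊆ A := by
    rintro ⟨s, y⟩ ⟨hs, -⟩
    exact mk_mem_prod ⟨ht.1.trans hs.1.le, hs.2.le.trans (min_le_right _ _)⟩ (mem_univ _)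
  have hUmeas : MeasurableSet U := measurableSet_Ioo.prod measurableSet_ball
  have hUpos : (volume : Measure (ℝ × ℝ³)) U ≠ 0 := by
    rw [hU, Measure.volume_eq_prod, Measure.prod_prod]
    refine (ENNReal.mul_pos ?_ (measure_ball_pos volume x hδ).ne').ne'
    rw [Real.volume_Ioo]
    simp [htt₂]
  have hbig : ∀ z ∈ U, S < ‖uncurry u z‖ₑ := by
    rintro ⟨s, y⟩ ⟨hs, hy⟩
    have hsW : ((s, y) : ℝ × ℝ³) ∈ W := by
      refine hball ?_
      rw [← ball_prod_same]
      refine mk_mem_prod ?_ hy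
      rw [Real.ball_eq_Ioo]
      exact ⟨by linarith [hs.1], lt_of_lt_of_le hs.2 (min_le_left _ _)⟩
    have hsS : ((s, y) : ℝ × ℝ³) ∈ Ico 0 T ×ˢ (univ : Set ℝ³) :=
      mk_mem_prod ⟨ht.1.trans hs.1.le, (hs.2.trans_le (min_le_right _ _)).trans hT''T⟩ (mem_univ _)
    have hKz : K < ‖uncurry u (s, y)‖ := hWsub ⟨hsW, hsS⟩
    rw [hSK, ← ofReal_norm]
    exact (ENNReal.ofReal_lt_ofReal_iff (lt_of_le_of_lt ENNReal.toReal_nonneg hKz)).2 hKz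
  exact false_of_ae_le_of_lt_on hae hUA hUmeas hUpos hbig

/-- **The blow-up of a counterexample happens AT `T`**: for every `M` and every `T' < T` there is a
time `t ∈ (T', T) ∩ [0, T)` and a point `x` with `‖u(t, x)‖ > M`, i.e.
`limsup_{t ↑ T} ‖u(t)‖_∞ = ∞` (`counterexample_unbounded` + `pointwise_bounded_before`). -/
theorem counterexample_blowup_at_T (hν : 0 < ν) (hT : 0 < T)
    (hcl : IsClassicalNSSolutionOn (Ico 0 T) ν 0 u p) (hLH : IsLerayHopfOn T ν 0 (u 0) u)
    (hdec : HasRapidSpatialDecay (u 0)) (hext : ¬ HasSmoothExtensionPast ν 0 u T) :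
    ∀ M T' : ℝ, T' < T → ∃ t ∈ Ioo T' T, 0 ≤ t ∧ ∃ x, M < ‖u t x‖ := by
  intro M T' hT'
  set T₀ : ℝ := max ((T' + T) / 2) 0 with hT₀
  have hT₀T : T₀ < T := max_lt (by linarith) hT
  have hT'T₀ : T' < T₀ := lt_of_lt_of_le (by linarith) (le_max_left _ _)
  obtain ⟨M₀, hM₀⟩ := pointwise_bounded_before hν hcl hLH hdec T₀ hT₀T
  obtain ⟨t, ht, x, hx⟩ := counterexample_unbounded hν hT hcl hLH hext (max M M₀)
  have hMx : M < ‖u t x‖ := lt_of_le_of_lt (le_max_left _ _) hx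
  rcases lt_or_ge T₀ t with hlt | hle
  · exact ⟨t, ⟨hT'T₀.trans hlt, ht.2⟩, ht.1, x, hMx⟩
  · exact absurd (hM₀ t ⟨ht.1, hle⟩ x) (not_le.2 (lt_of_le_of_lt (le_max_right _ _) hx))

/-- **The axisymmetric case of the crux is a theorem of the tree** (Koch–Nadirashvili–Seregin–
Šverák 2009 Thms 6.1–6.2 / Seregin–Šverák 2009 Thm 1.1, discharged as
`knss_no_axisymmetric_typeI_holds`; its sub-slab boundedness hypothesis is
`pointwise_bounded_before`). -/
theorem target_axisymmetric (hν : 0 < ν) (hT : 0 < T)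
    (hcl : IsClassicalNSSolutionOn (Ico 0 T) ν 0 u p) (hLH : IsLerayHopfOn T ν 0 (u 0) u)
    (hdec : HasRapidSpatialDecay (u 0)) (hI : IsTypeIBlowup u T)
    (haxi : ∀ t ∈ Ico 0 T, IsAxisymmetric (u t)) : HasSmoothExtensionPast ν 0 u T :=
  knss_no_axisymmetric_typeI_holds hν hT hcl hLH (pointwise_bounded_before hν hcl hLH hdec) haxi
    (Or.inl hI)

/-- **A counterexample is not axisymmetric** (about the fixed axis of `IsAxisymmetric`; by the
rotation and translation invariance of all clauses, about no axis). The axisymmetric case of the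
provers' LOCAL statement (`LocalPressureLoadBearing.LocalTypeIRegularity`) is likewise a theorem of
the tree: the discharged barrier `AxisymmetricTypeIExclusion_holds` (Seregin–Šverák 2009 Thm 3.1). -/
theorem counterexample_not_axisymmetric (hν : 0 < ν) (hT : 0 < T)
    (hcl : IsClassicalNSSolutionOn (Ico 0 T) ν 0 u p) (hLH : IsLerayHopfOn T ν 0 (u 0) u)
    (hdec : HasRapidSpatialDecay (u 0)) (hI : IsTypeIBlowup u T)
    (hext : ¬ HasSmoothExtensionPast ν 0 u T) : ¬ ∀ t ∈ Ico 0 T, IsAxisymmetric (u t) :=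
  fun haxi => hext (target_axisymmetric hν hT hcl hLH hdec hI haxi)

/-- **Exactly backward self-similar blow-up is excluded** (Leray's 1934 question; Nečas–Růžička–
Šverák 1996, Tsai 1998 Thm 2 — discharged in the tree as `LeraySelfSimilarBlowupExclusion_holds`):
if a solution as in the crux coincides on a final interval `(t₀, T)` with Leray's ansatz
`(2a(T−t))^{-1/2} U(x/√(2a(T−t)))` for a `C²` profile pair `(U, P)` solving Leray's system, then
`U = 0` (the Leray–Hopf class supplies Tsai's local energy estimates: energy from
`IsLerayHopfOn.lintegral_enorm_sq_le`, dissipation through the classical gradient from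
`IsLerayHopfOn.lintegral_frobeniusNormSq_fderiv_of_classical`), so `u` vanishes near `T`, is
bounded on `[0, T)` (`pointwise_bounded_before`) and extends. A counterexample is therefore not
exactly self-similar; the Type-I hypothesis is not even needed. -/
theorem target_selfSimilar (hν : 0 < ν) (hT : 0 < T)
    (hcl : IsClassicalNSSolutionOn (Ico 0 T) ν 0 u p) (hLH : IsLerayHopfOn T ν 0 (u 0) u)
    (hdec : HasRapidSpatialDecay (u 0)) {a t₀ : ℝ} (ha : 0 < a) (ht₀0 : 0 ≤ t₀) (ht₀ : t₀ < T)
    {U : ℝ³ → ℝ³} {P : ℝ³ → ℝ} (hprof : IsLerayProfile ν a U P)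
    (hss : ∀ t ∈ Ioo t₀ T, u t = lerayBackward a T U t) : HasSmoothExtensionPast ν 0 u T := by
  have hU0 : U = 0 := by
    refine LeraySelfSimilarBlowupExclusion_holds.tsai_localEnergy hν ha ht₀ hprof ?_ ?_
    · -- local energy on the unit ball from the global energy bound
      refine ⟨(2 * VectorCalculus.kineticEnergy (u 0)).toNNReal, fun t ht => ?_⟩
      rw [← hss t ht]
      calc ∫⁻ x in Metric.ball (0 : ℝ³) 1, ‖u t x‖ₑ ^ 2 ≤ ∫⁻ x, ‖u t x‖ₑ ^ 2 :=
            setLIntegral_le_lintegral _ _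
        _ ≤ ENNReal.ofReal (2 * VectorCalculus.kineticEnergy (u 0)) :=
            hLH.lintegral_enorm_sq_le hν.le ⟨ht₀0.trans ht.1.le, ht.2.le⟩
        _ = ((2 * VectorCalculus.kineticEnergy (u 0)).toNNReal : ENNReal) := rfl
    · -- local dissipation from the global one, through the classical gradient
      have hglob := (hLH.lintegral_frobeniusNormSq_fderiv_of_classical hcl hT).1
      refine lt_of_le_of_lt ?_ (lt_top_iff_ne_top.2 hglob)
      calc ∫⁻ t in Ioo t₀ T, ∫⁻ x in Metric.ball (0 : ℝ³) 1,
              ENNReal.ofReal (frobeniusNormSq (fderiv ℝ (lerayBackward a T U t) x))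
          = ∫⁻ t in Ioo t₀ T, ∫⁻ x in Metric.ball (0 : ℝ³) 1,
              ENNReal.ofReal (frobeniusNormSq (fderiv ℝ (u t) x)) := by
            refine setLIntegral_congr_fun measurableSet_Ioo (fun t ht => ?_)
            rw [← hss t ht]
        _ ≤ ∫⁻ t in Ioo t₀ T, ∫⁻ x, ENNReal.ofReal (frobeniusNormSq (fderiv ℝ (u t) x)) :=
            lintegral_mono fun t => setLIntegral_le_lintegral _ _
        _ ≤ ∫⁻ t in Ioo 0 T, ∫⁻ x, ENNReal.ofReal (frobeniusNormSq (fderiv ℝ (u t) x)) :=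
            lintegral_mono_set (Ioo_subset_Ioo_left ht₀0)
  -- `u = 0` on `(t₀, T)`; bounded before by `pointwise_bounded_before`
  obtain ⟨M, hM⟩ := pointwise_bounded_before hν hcl hLH hdec ((t₀ + T) / 2) (by linarith)
  refine hasSmoothExtensionPast_of_bounded_holds hν hT hcl hLH ⟨max M 0, fun t ht x => ?_⟩
  rcases le_or_gt t ((t₀ + T) / 2) with hle | hlt
  · exact (hM t ⟨ht.1, hle⟩ x).trans (le_max_left _ _)
  · have htI : t ∈ Ioo t₀ T := ⟨by linarith, ht.2⟩
    rw [hss t htI, hU0, lerayBackward_apply]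
    simp

/-- **`λ`-discretely self-similar blow-up with `λ` near `1` is excluded** (Chae–Wolf 2017 Thm 1.3,
discharged in the tree as `chaeWolf2017_removing_dss_holds`; normal form `ν = 1`, cf. §6): for
every Type-I decay constant `C₀ > 0` there is `c₁ > 1` such that for `1 < c < c₁`, a crux-class
solution which coincides on a final interval `(t₀, T)` with the time-shift of an ancient classical
`c`-DSS solution `w` obeying `‖w(t, x)‖ ≤ C₀ / (‖x‖ + √(-t))` extends past `T` (`w ≡ 0`, so `u`
vanishes near `T` and is bounded on `[0, T)`). A counterexample modelled on a DSS ancient solution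
needs a scaling factor `c ≥ c₁(C₀)` — the open wall `TypeIDSSLiouvilleConjecture`. -/
theorem target_dss_near_one {C₀ : ℝ} (hC₀ : 0 < C₀) :
    ∃ c₁ : ℝ, 1 < c₁ ∧ ∀ c : ℝ, 1 < c → c < c₁ →
      ∀ {T : ℝ} {u : ℝ → ℝ³ → ℝ³} {p : ℝ → ℝ³ → ℝ}, 0 < T →
        IsClassicalNSSolutionOn (Ico 0 T) 1 0 u p → IsLerayHopfOn T 1 0 (u 0) u →
        HasRapidSpatialDecay (u 0) →
        ∀ {w : ℝ → ℝ³ → ℝ³} {π : ℝ → ℝ³ → ℝ} {t₀ : ℝ}, IsClassicalNSSolutionOn (Iio 0) 1 0 w π →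
          IsDiscretelySelfSimilar c w → HasTypeIDecay C₀ w → t₀ < T →
          (∀ t ∈ Ioo t₀ T, ∀ x, u t x = w (t - T) x) → HasSmoothExtensionPast 1 0 u T := by
  obtain ⟨c₁, hc₁, hc⟩ := chaeWolf2017_removing_dss_holds C₀ hC₀
  refine ⟨c₁, hc₁, fun c h1 h2 T u p hT hcl hLH hdec w π t₀ hw hdss hdecay ht₀ hagree => ?_⟩
  have hw0 : ∀ t < 0, ∀ x, w t x = 0 := hc c h1 h2 w π hw hdss hdecay
  -- `u = 0` on `(t₀, T)`; bounded before
  set T' : ℝ := (max t₀ 0 + T) / 2 with hT'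
  have hmax : max t₀ 0 < T := max_lt ht₀ hT
  have hT'T : T' < T := by rw [hT']; linarith
  have ht₀T' : t₀ < T' := by
    have : t₀ ≤ max t₀ 0 := le_max_left _ _
    rw [hT']; linarith
  obtain ⟨M, hM⟩ := pointwise_bounded_before one_pos hcl hLH hdec T' hT'T
  refine hasSmoothExtensionPast_of_bounded_holds one_pos hT hcl hLH ⟨max M 0, fun t ht x => ?_⟩
  rcases le_or_gt t T' with hle | hlt
  · exact (hM t ⟨ht.1, hle⟩ x).trans (le_max_left _ _)
  · rw [hagree t ⟨ht₀T'.trans hlt, ht.2⟩ x, hw0 (t - T) (by linarith [ht.2]) x, norm_zero]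
    exact le_max_right _ _

end Profile


/-! ## §4b What a kill must contain (gen 3; contrapositives of the provers' landed reductions) -/

section Kill

/-- **A counterexample to the crux yields an Albritton–Barker local Type-I singular point**
(`LocalTypeISingularityExists`, the registered OPEN first bullet of A–B 2019 Thm. 1.1: a suitable
weak solution in a parabolic ball whose centre is a backward singular point with
`𝐈 = sup (A + C + D + E) < ∞`). Unconditional: contrapositive of the provers' landed
`Theorems.noTypeIBlowup_of_not_localTypeISingularityExists` (Morrey bound from the Type-I rate
+ zoom + Lemarié-Rieusset continuation). So a refutation of stmt-1217 settles that open
existence question positively — there is no cheaper kill. -/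
theorem localTypeISingularityExists_of_not_target (h : ¬ Target) : LocalTypeISingularityExists := by
  by_contra hno
  exact h (Theorems.noTypeIBlowup_of_not_localTypeISingularityExists hno)

/-- … hence, modulo the vendored forward half of Albritton–Barker 2019 Thm. 1.1
(`AlbrittonBarkerForward`, Seregin–Šverák rescaling), **a counterexample yields a non-trivial
mild bounded ancient solution with `𝐈 < ∞`** (`NontrivialMildAncientTypeIExists`) — the
Liouville-type object of KNSS 2009. -/
theorem nontrivialMildAncientTypeIExists_of_not_target (hAB : AlbrittonBarkerForward)
    (h : ¬ Target) : NontrivialMildAncientTypeIExists :=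
  hAB (localTypeISingularityExists_of_not_target h)

/-- … and, modulo the measurable-slice form of that forward half (hypothesis `hABm` of the
provers' `Theorems.noTypeIBlowup_of_liouvilleConjectureNS`, true for the printed construction),
**a counterexample REFUTES the Liouville conjecture (L) of Koch–Nadirashvili–Seregin–Šverák**
(`LiouvilleConjectureNS`, items stmt-…-0057 / stmt-…-10661): killing this crux is at least as hard
as disproving (L). -/
theorem not_liouvilleConjectureNS_of_not_target
    (hABm : LocalTypeISingularityExists →
      ∃ (u : ℝ → ℝ³ → ℝ³) (p : ℝ → ℝ³ → ℝ) (G : ℝ → ℝ³ → ℝ³ →L[ℝ] ℝ³),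
      (∀ t < 0, AEStronglyMeasurable (u t) volume) ∧
      IsBoundedAncientMildSolution 1 u ∧
      IsSuitableWeakSolutionOn (slab ℝ³ (Iio 0) isOpen_Iio) 1 0 u p ∧
      HasWeakSpatialGradientOn (slab ℝ³ (Iio 0) isOpen_Iio) u G ∧
      ¬ (uncurry u =ᵐ[volume.restrict (Iio (0 : ℝ) ×ˢ (univ : Set ℝ³))] 0) ∧
      typeIBound (Iio (0 : ℝ) ×ˢ (univ : Set ℝ³)) u p G < ⊤)
    (h : ¬ Target) : ¬ LiouvilleConjectureNS := fun hL =>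
  h (Theorems.noTypeIBlowup_of_liouvilleConjectureNS hABm hL)

end Kill

end Summit.NavierStokesRegularity.NavierStokesRegularity.Theorems.Target.Negative

end
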